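import Literature.Geometry.Riemannian.ThreeShrinkerClassificationAssembly
import Literature.Geometry.Riemannian.ThreeShrinkerSectionalNonneg
import HarnessLib

/-!
# Classification of three-dimensional shrinkers: assembly modulo (F2) alone

`ThreeShrinkerClassificationAssembly.lean` reduces the named fact
`threeShrinkerClassification_modelData` (Munteanu–Wang 2016, Thm. 1.2: a complete connected
normalised three-dimensional gradient shrinker has the model data of `ℝ³`, `S³/Γ`, `S²×ℝ` or
`(S²×ℝ)/ℤ₂`) to two curvature inputs on the noncompact `R > 0` case: **(F1)** `Ric ≥ 0`
(B.-L. Chen 2009, Cor. 2.4) and **(F2)** a null vector of `Ric` (Munteanu–Wang 2017, Thm. 2,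
contrapositive; Perelman). **(F1) is now a theorem of the tree** (`ThreeShrinker.ricci_nonneg`,
`ThreeShrinkerSectionalNonneg.lean`, by the elliptic Hamilton–Ivey estimate), so:

* **`ThreeShrinker.modelData_of_F2`** — the model data for a given soliton from (F2) for it;
* **`threeShrinkerClassification_modelData_of_F2`** — the named fact from (F2) for every member
  of the binder.

What remains for the discharge of `threeShrinkerClassification_modelData` is (F2) alone:
"a complete noncompact three-dimensional gradient shrinker with `R > 0` (hence, by (F1),
`Ric ≥ 0` and `sect ≥ 0`) has a null vector of `Ric` somewhere", i.e. the compactness theorem of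
Munteanu–Wang 2017, Thm. 2 / Perelman for `sect ≥ 0`, `Ric > 0`. Everything here is proved.

## References

* O. Munteanu, J. Wang, arXiv:1606.01861, Thm. 1.2 (p. 3). [MunteanuWang2016]
* B.-L. Chen, J. Differential Geom. 82 (2009), Cor. 2.4. [Chen2009]
* O. Munteanu, J. Wang, J. Differential Geom. 106 (2017), Thm. 2. [MunteanuWang2017]
-/

noncomputable section

open Bundle Set Function Filter Module Metric MeasureTheory
open scoped Manifold ContDiff Topology NNReal ENNReal

namespace Literature.Geometry.Riemannian

open Lorentzian Lorentzian.PseudoRiemannianMetric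

namespace ThreeShrinker

/-- **Munteanu–Wang 2016, Thm. 1.2, modulo (F2) only**: for a complete connected normalised
three-dimensional gradient shrinker, if in the noncompact case with `R > 0` a null vector of
`Ric` exists (F2), then the model data of `threeShrinkerClassification_modelData` hold; the
input (F1) `Ric ≥ 0` of `modelData_of_curvature_inputs` is supplied by `ThreeShrinker.ricci_nonneg`.
[cite: MunteanuWang2016, Thm. 1.2 (p. 3)] [cite: Chen2009, Cor. 2.4] [cite: MunteanuWang2017, Thm. 2] -/
theorem modelData_of_F2 (N : Type) [TopologicalSpace N] [T2Space N]
    [SecondCountableTopology N] [ChartedSpace (EuclideanSpace ℝ (Fin 3)) N] [IsManifold (𝓡 3) ∞ N]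
    [ConnectedSpace N] [T3Space N] [MeasurableSpace N] [BorelSpace N]
    (h : PseudoRiemannianMetric (𝓡 3) ∞ (EuclideanSpace ℝ (Fin 3))
      (TangentSpace (𝓡 3) : N → Type _)) [h.HasLeviCivita] (φ : N → ℝ) (hh : h.IsRiemannian)
    (hcpl : ∀ (x : N) (r : ℝ≥0), IsCompact {y : N | h.edist hh x y ≤ r})
    (hφ : ContMDiff (𝓡 3) 𝓘(ℝ, ℝ) ∞ φ)
    (hsol : ∀ (x : N) (X Y : TangentSpace (𝓡 3) x),
      h.ricci x X Y + h.hessian φ x X Y = (1 / 2 : ℝ) * h.val x X Y)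
    (hnorm : ∀ x : N, h.scalarCurvature x + h.gradSq φ x = φ x)
    (hF2 : NoncompactSpace N → (∀ x : N, 0 < h.scalarCurvature x) →
      ∃ (p : N) (w : TangentSpace (𝓡 3) p), w ≠ 0 ∧ h.ricci p w w = 0) :
    ((∀ x : N, h.scalarCurvature x = 0) ∧
        ∫⁻ x, ENNReal.ofReal (Real.exp (-φ x))
            ∂(riemannianMeasure (h.toContMDiffRiemannianMetric hh)) =
          ENNReal.ofReal (8 * Real.pi * Real.sqrt Real.pi)) ∨
      (CompactSpace N ∧ (∀ x : N, h.scalarCurvature x = 3 / 2) ∧ (∀ x : N, φ x = 3 / 2) ∧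
        ∃ k : ℕ, 0 < k ∧
          riemannianMeasure (h.toContMDiffRiemannianMetric hh) Set.univ =
            ENNReal.ofReal (16 * Real.pi ^ 2 / k)) ∨
      ((∀ x : N, h.scalarCurvature x = 1) ∧
        ∫⁻ x, ENNReal.ofReal (Real.exp (-φ x))
            ∂(riemannianMeasure (h.toContMDiffRiemannianMetric hh)) =
          ENNReal.ofReal (16 * Real.pi * Real.sqrt Real.pi * Real.exp (-1))) ∨
      ((∀ x : N, h.scalarCurvature x = 1) ∧
        ∫⁻ x, ENNReal.ofReal (Real.exp (-φ x))
            ∂(riemannianMeasure (h.toContMDiffRiemannianMetric hh)) =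
          ENNReal.ofReal (8 * Real.pi * Real.sqrt Real.pi * Real.exp (-1))) :=
  modelData_of_curvature_inputs N h φ hh hcpl hφ hsol hnorm
    (fun _ _ x w ↦ ricci_nonneg h φ hh hcpl hφ hsol hnorm x w) hF2

end ThreeShrinker

/-- **The named fact `threeShrinkerClassification_modelData` from (F2) alone**: if every complete
connected normalised noncompact three-dimensional gradient shrinker with `R > 0` has a null vector
of `Ric` (Munteanu–Wang 2017, Thm. 2, contrapositive), the classification fact follows —
(F1) `Ric ≥ 0` being the theorem `ThreeShrinker.ricci_nonneg`.
[cite: MunteanuWang2016, Thm. 1.2 (p. 3)] [cite: MunteanuWang2017, Thm. 2] [cite: Chen2009, Cor. 2.4] -/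
theorem threeShrinkerClassification_modelData_of_F2
    (hF2 : ∀ (N : Type) [TopologicalSpace N] [T2Space N] [SecondCountableTopology N]
      [ChartedSpace (EuclideanSpace ℝ (Fin 3)) N] [IsManifold (𝓡 3) ∞ N] [ConnectedSpace N]
      [T3Space N] [MeasurableSpace N] [BorelSpace N]
      (h : PseudoRiemannianMetric (𝓡 3) ∞ (EuclideanSpace ℝ (Fin 3))
        (TangentSpace (𝓡 3) : N → Type _)) [h.HasLeviCivita] (φ : N → ℝ) (hh : h.IsRiemannian),
      (∀ (x : N) (r : ℝ≥0), IsCompact {y : N | h.edist hh x y ≤ r}) →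
      ContMDiff (𝓡 3) 𝓘(ℝ, ℝ) ∞ φ →
      (∀ (x : N) (X Y : TangentSpace (𝓡 3) x),
        h.ricci x X Y + h.hessian φ x X Y = (1 / 2 : ℝ) * h.val x X Y) →
      (∀ x : N, h.scalarCurvature x + h.gradSq φ x = φ x) →
      NoncompactSpace N → (∀ x : N, 0 < h.scalarCurvature x) →
      ∃ (p : N) (w : TangentSpace (𝓡 3) p), w ≠ 0 ∧ h.ricci p w w = 0) :
    threeShrinkerClassification_modelData := by
  intro N _ _ _ _ _ _ _ _ _ h _ φ hh hcpl hφ hsol hnorm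
  exact ThreeShrinker.modelData_of_F2 N h φ hh hcpl hφ hsol hnorm (hF2 N h φ hh hcpl hφ hsol hnorm)

end Literature.Geometry.Riemannian

end
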